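import Summits.CriticalPhenomena.PercolationContinuityZ3.Theorems.PercAnnulusCrossingIICThinningFiniteVolume
import Mathlib.MeasureTheory.Integral.DominatedConvergence
import HarnessLib

/-!
# Thinning commutes with Kesten's limit: the law of the thinned arm-conditioned cluster converges to the thinned IIC (lane RSW3, p1 gen 12)

builds on p205010 (kernel theorem, internal audit signed; external expert review pending) — NOT used in this file (every `p`).

RSW3 lane (LANE 3 `prim-rsw3`), seat `prim-rsw3-p1` (gen 12); memo `run/shared/lean/prim/rsw3/P1-QM.md` §25.  Helper file for the crux
`stmt-CriticalPhenomena-4575` chain; no definitions, no sorries; every `d`, every `p` with `0 < p`.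

The census quantity of `…IICThinningFiniteVolume` (`P_p ⊗ P_q(ω ∩ ξ ∈ A | ω ∈ A_n)`, finite volume, no IIC) and the kernel object of `…IICThinning` /
`…IICCriticalInside` (`(ν ⊗ P_q){ω ∩ ξ ∈ A}`, the thinned IIC) are the same in the limit `n → ∞`: for every measure `ν` with Kesten's IIC limit property at `p`
and every cylinder event `A`,

* `prod_real_setOf_inter_mem_inter_eq_integral`, `prod_real_setOf_inter_mem_eq_integral` — Tonelli in real form;
* **`tendsto_prod_real_thinned_cond`** — **`P_p ⊗ P_q({ω ∩ ξ ∈ A} ∩ {ω ∈ A_n}) / π_p(n) → (ν ⊗ P_q){ω ∩ ξ ∈ A}`**: each section `{ω | ω ∩ ξ ∈ A}` is a cylinder,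
  so the IIC limit property applies pointwise in `ξ`, and the ratios are bounded by `1` (dominated convergence) — THINNING COMMUTES WITH KESTEN'S LIMIT;
* `tendsto_prod_real_thinned_arm_cond` — in particular for the thinned arm `A = A_m`: the conditional thinned-arm probabilities of the census converge to
  the thinned IIC arm probability pinned by `…IICThinning` between `π_{qp}(m)` and `π_{qp}(m)/(c π_p(m+1))`.
References: H. Kesten, PTRF 73 (1986) Thm. (3); D. Basu, A. Sapozhnikov, ECP 22 (2017) no. 26, Thm 1.1; G. Grimmett, *Percolation* (1999), §1.3, §2.2.
-/

noncomputable section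

namespace Summit.CriticalPhenomena.PercolationContinuityZ3.Theorems.Crossing

open MeasureTheory ProbabilityTheory Filter Topology
open Literature.Probability.Percolation Literature.Probability.LatticeModels
open Literature.Probability.Percolation.DCT16
open scoped ENNReal ProbabilityTheory

variable {d : ℕ}

section General

variable {V : Type*}

/-- **Tonelli, real form**: `(μ ⊗ ρ){ω ∩ ξ ∈ A, ω ∈ B} = ∫ μ({ω | ω ∩ ξ ∈ A} ∩ B) dρ(ξ)` for finite measures. [folklore] -/
theorem prod_real_setOf_inter_mem_inter_eq_integral (μ ρ : Measure (BondConfig V)) [IsFiniteMeasure μ] [IsFiniteMeasure ρ] {A B : Set (BondConfig V)}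
    (hA : MeasurableSet A) (hB : MeasurableSet B) :
    (μ.prod ρ).real {π : BondConfig V × BondConfig V | π.1 ∩ π.2 ∈ A ∧ π.1 ∈ B} =
      ∫ ξ, μ.real ({ω : BondConfig V | ω ∩ ξ ∈ A} ∩ B) ∂ρ := by
  rw [measureReal_def, prod_setOf_inter_mem_inter_eq_lintegral μ ρ hA hB,
    ← integral_toReal (measurable_section_setOf_inter_mem_inter μ hA hB).aemeasurable (Eventually.of_forall fun ξ => measure_lt_top _ _)]
  rfl

/-- **Tonelli, real form**: `(μ ⊗ ρ){ω ∩ ξ ∈ A} = ∫ μ{ω | ω ∩ ξ ∈ A} dρ(ξ)` for finite measures. [folklore] -/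
theorem prod_real_setOf_inter_mem_eq_integral (μ ρ : Measure (BondConfig V)) [IsFiniteMeasure μ] [IsFiniteMeasure ρ] {A : Set (BondConfig V)}
    (hA : MeasurableSet A) :
    (μ.prod ρ).real {π : BondConfig V × BondConfig V | π.1 ∩ π.2 ∈ A} = ∫ ξ, μ.real {ω : BondConfig V | ω ∩ ξ ∈ A} ∂ρ := by
  rw [measureReal_def, prod_setOf_inter_mem_eq_lintegral μ ρ hA,
    ← integral_toReal (measurable_section_setOf_inter_mem μ hA).aemeasurable (Eventually.of_forall fun ξ => measure_lt_top _ _)]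
  rfl

end General

/-- **THINNING COMMUTES WITH KESTEN'S LIMIT**: for every measure `ν` with the IIC limit property at `p` (`d ≥ 1`, `0 < p`), every `q` and every cylinder
event `A` (measurable, determined by a finite pair set):
**`(P_p ⊗ P_q)({ω ∩ ξ ∈ A} ∩ {ω ∈ A_n}) / π_p(n) → (ν ⊗ P_q){ω ∩ ξ ∈ A}`** — the law of the `q`-thinned arm-conditioned cluster converges, on cylinders, to the
law of the `q`-thinned IIC (dominated convergence over the filter `ξ`: every section is a cylinder, every ratio is at most `1`).
[cite: Kesten1986, Thm. (3)] [cite: BasuSapozhnikov2017ECP, Thm. 1.1] -/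
theorem tendsto_prod_real_thinned_cond (hd : 1 ≤ d) (p : unitInterval) (hp : 0 < (p : ℝ)) (q : unitInterval)
    {ν : Measure (BondConfig (Site d))} [IsProbabilityMeasure ν]
    (hν : ∀ (F : Finset (Sym2 (Site d))) (E : Set (BondConfig (Site d))), MeasurableSet E → DeterminedBy E ↑F →
      Tendsto (fun n : ℕ => (bondPercolation (zdGraph d) p).real (E ∩ siteToBoundary d n) / oneArmProb d p n)
        atTop (𝓝 (ν.real E)))
    {F : Finset (Sym2 (Site d))} {A : Set (BondConfig (Site d))} (hA : DeterminedBy A (↑F : Set (Sym2 (Site d)))) :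
    Tendsto (fun n : ℕ => ((bondPercolation (zdGraph d) p).prod (bondPercolation (zdGraph d) q)).real
        {π : BondConfig (Site d) × BondConfig (Site d) | π.1 ∩ π.2 ∈ A ∧ π.1 ∈ siteToBoundary d n} / oneArmProb d p n) atTop
      (𝓝 ((ν.prod (bondPercolation (zdGraph d) q)).real {π : BondConfig (Site d) × BondConfig (Site d) | π.1 ∩ π.2 ∈ A})) := by
  set P := bondPercolation (zdGraph d) p with hP
  set Q := bondPercolation (zdGraph d) q with hQ
  have hAm : MeasurableSet A := hA.measurableSet_of_finset
  have hπ : ∀ n, 0 < oneArmProb d p n := oneArmProb_pos hd p hp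
  -- the integrands and their limit
  set Fn : ℕ → BondConfig (Site d) → ℝ := fun n ξ => P.real ({ω : BondConfig (Site d) | ω ∩ ξ ∈ A} ∩ siteToBoundary d n) / oneArmProb d p n with hFn
  set f : BondConfig (Site d) → ℝ := fun ξ => ν.real {ω : BondConfig (Site d) | ω ∩ ξ ∈ A} with hf
  have hrewrite : ∀ n, (P.prod Q).real {π : BondConfig (Site d) × BondConfig (Site d) | π.1 ∩ π.2 ∈ A ∧ π.1 ∈ siteToBoundary d n} / oneArmProb d p n =
      ∫ ξ, Fn n ξ ∂Q := by
    intro n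
    rw [prod_real_setOf_inter_mem_inter_eq_integral P Q hAm (measurableSet_siteToBoundary d n), ← integral_div]
  have hlim_eq : (ν.prod Q).real {π : BondConfig (Site d) × BondConfig (Site d) | π.1 ∩ π.2 ∈ A} = ∫ ξ, f ξ ∂Q :=
    prod_real_setOf_inter_mem_eq_integral ν Q hAm
  simp_rw [hrewrite]
  rw [hlim_eq]
  refine tendsto_integral_of_dominated_convergence (fun _ => (1 : ℝ)) (fun n => ?_) (integrable_const 1) (fun n => ?_) ?_
  · -- measurability of the section ratios
    have hm : Measurable fun ξ : BondConfig (Site d) => P ({ω : BondConfig (Site d) | ω ∩ ξ ∈ A} ∩ siteToBoundary d n) :=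
      measurable_section_setOf_inter_mem_inter P hAm (measurableSet_siteToBoundary d n)
    exact (hm.ennreal_toReal.div_const _).aestronglyMeasurable
  · -- the ratios are at most `1`
    refine Eventually.of_forall fun ξ => ?_
    rw [Real.norm_eq_abs, abs_of_nonneg (div_nonneg measureReal_nonneg (hπ n).le), div_le_one (hπ n), oneArmProb, oneArm]
    exact measureReal_mono Set.inter_subset_right (measure_ne_top _ _)
  · -- pointwise convergence: each section is a cylinder
    exact Eventually.of_forall fun ξ => hν F _ (measurableSet_setOf_inter_mem hAm ξ) (determinedBy_setOf_inter_mem hA ξ)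

/-- **The census thinned-arm ratios converge to the thinned IIC arm probability**: for every IIC measure `ν` at `p` (`d ≥ 1`, `0 < p`), every `q`, `m`:
`P_p ⊗ P_q(A_m(ω ∩ ξ), A_n(ω)) / π_p(n) → (ν ⊗ P_q){A_m(ω ∩ ξ)}` as `n → ∞`. [cite: Kesten1986, Thm. (3)] [cite: BasuSapozhnikov2017ECP, Thm. 1.1] -/
theorem tendsto_prod_real_thinned_arm_cond (hd : 1 ≤ d) (p : unitInterval) (hp : 0 < (p : ℝ)) (q : unitInterval)
    {ν : Measure (BondConfig (Site d))} [IsProbabilityMeasure ν]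
    (hν : ∀ (F : Finset (Sym2 (Site d))) (E : Set (BondConfig (Site d))), MeasurableSet E → DeterminedBy E ↑F →
      Tendsto (fun n : ℕ => (bondPercolation (zdGraph d) p).real (E ∩ siteToBoundary d n) / oneArmProb d p n)
        atTop (𝓝 (ν.real E)))
    (m : ℕ) :
    Tendsto (fun n : ℕ => ((bondPercolation (zdGraph d) p).prod (bondPercolation (zdGraph d) q)).real
        {π : BondConfig (Site d) × BondConfig (Site d) | π.1 ∩ π.2 ∈ siteToBoundary d m ∧ π.1 ∈ siteToBoundary d n} / oneArmProb d p n) atTop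
      (𝓝 ((ν.prod (bondPercolation (zdGraph d) q)).real {π : BondConfig (Site d) × BondConfig (Site d) | π.1 ∩ π.2 ∈ siteToBoundary d m})) :=
  tendsto_prod_real_thinned_cond hd p hp q hν (determinedBy_siteToBoundary d m)

end Summit.CriticalPhenomena.PercolationContinuityZ3.Theorems.Crossing

end
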